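import Summits.PneNP.PneNP.Theorems.ExpanderLinearGeneratorsLinearGeneratorModPFregeHardMod2Easy
import Summits.PneNP.PneNP.Theorems.ExpanderLinearGeneratorsLinearGeneratorModPFregeHardMod2Sparse
import Summits.PneNP.PneNP.Theorems.ExpanderLinearGeneratorsLinearGeneratorDepthFregeHardDepthFloor
import Mathlib.Analysis.SpecialFunctions.Pow.Real
import Mathlib.Analysis.SpecialFunctions.Log.Basic
import HarnessLib

/-!
# The `p = 2` analogue of `LinearGeneratorModPFregeHard` holds only vacuously

Support file for item `stmt-PneNP-11444` (`LinearGeneratorModPFregeHard`, the `AC⁰[p]`-Frege rung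
of route `ExpanderLinearGenerators`, stated for primes `p ≠ 2`).  Its docstring claims: "For
`p = 2` … the statement is FALSE: `MOD₂` gates sum the certificate rows in polynomial size".
Here the claim is kernel-checked in the following exact form: the statement obtained from the rung
by putting `p = 2` (`linearGeneratorModTwoFregeHard` below, spelled out as a hypothesis) IMPLIES
that for every locality `ℓ ≥ 1` and rate `0 < δ < 1`, all sufficiently large `ℓ`-sparse
`(n^(1-δ), 3ℓ/4)`-boundary-expanding systems over `𝔽₂` are SOLVABLE — i.e. it can only hold
because its hypotheses are eventually contradictory, never as a lower bound: on an unsolvable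
instance the polynomial-size depth-35 `F(MOD₂)`-refutation of `…Mod2Easy.lean`
(`exists_modTwo_refutation`) beats `2^(n^ε)` (expansion forces distinct supports, so the instance
and its encoding are polynomial in `n`, `…Mod2Sparse.lean`; and `K·(n+1)^c < 2^(n^ε)` eventually,
`exists_nat_poly_lt_two_rpow`).

No definitions are introduced (the `p = 2` statement appears as the hypothesis of the theorem).

Sources: S. Buss et al., Comput. Complexity 6 (1996/97), Def. 1.1; J. Krajíček, *Proof Complexity*
(CUP 2019), §15.6; folklore.
-/

set_option linter.dupNamespace false -- `Summit.PneNP.PneNP.…`: summit = sub-problem (D-0017)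

namespace Summit.PneNP.PneNP.Theorems.ModTwo

open Literature.Computability.Complexity Literature.Computability.Complexity.PropForm
open Literature.Computability.MetaComplexity

/-! ### Polynomials are eventually below `2^(n^ε)` -/

/-- **`K·(n+1)^c < 2^(n^ε)` for all large `n`** (`ε > 0`): take logarithms, bound
`log (n+1) ≤ (4/ε)·n^(ε/2)` (`log x ≤ x^t/t` with `t = ε/4` and `n + 1 ≤ n²`), and compare the
linear and quadratic terms in `z = n^(ε/2)`. [folklore] -/
theorem exists_nat_poly_lt_two_rpow (K c : ℕ) {ε : ℝ} (hε : 0 < ε) :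
    ∃ N : ℕ, ∀ n : ℕ, N ≤ n → ((K * (n + 1) ^ c : ℕ) : ℝ) < (2 : ℝ) ^ ((n : ℝ) ^ ε) := by
  have hlog2 : 0 < Real.log 2 := Real.log_pos one_lt_two
  -- the threshold for `z = n^(ε/2)`
  set Z₀ : ℝ := ((K : ℝ) + 4 * c / ε + 1) / Real.log 2 + 1 with hZ₀
  have hZ₀1 : 1 ≤ Z₀ := by
    have : 0 ≤ ((K : ℝ) + 4 * c / ε + 1) / Real.log 2 := by positivity
    linarith
  have hZ₀pos : 0 ≤ Z₀ := by linarith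
  refine ⟨⌈Z₀ ^ (1 / (ε / 2))⌉₊ + 2, fun n hn => ?_⟩
  have hn2 : (2 : ℝ) ≤ n := by exact_mod_cast (show 2 ≤ n by omega)
  have hn0 : (0 : ℝ) < n := by linarith
  set z : ℝ := (n : ℝ) ^ (ε / 2) with hz
  have hzZ : Z₀ ≤ z := by
    -- `Z₀ = (Z₀^(1/e))^e ≤ n^e` for `e = ε/2`, since `⌈Z₀^(1/e)⌉ ≤ n`
    have he : (0 : ℝ) < ε / 2 := by linarith
    have hy : Z₀ ^ (1 / (ε / 2)) ≤ n := (Nat.le_ceil _).trans (by exact_mod_cast (show _ ≤ n by omega))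
    calc Z₀ = (Z₀ ^ (1 / (ε / 2))) ^ (ε / 2) := by
          rw [← Real.rpow_mul hZ₀pos, one_div, inv_mul_cancel₀ he.ne', Real.rpow_one]
      _ ≤ (n : ℝ) ^ (ε / 2) := Real.rpow_le_rpow (Real.rpow_nonneg hZ₀pos _) hy he.le
  have hz1 : 1 ≤ z := by linarith [hzZ]
  have hz0 : 0 < z := by linarith
  -- `n^ε = z²`
  have hnε : (n : ℝ) ^ ε = z ^ 2 := by
    rw [hz, ← Real.rpow_natCast, ← Real.rpow_mul hn0.le]
    congr 1; push_cast; ring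
  -- `log (n+1) ≤ (4/ε) z`
  have hlogn : Real.log ((n : ℝ) + 1) ≤ 4 / ε * z := by
    have h1 : Real.log ((n : ℝ) + 1) ≤ ((n : ℝ) + 1) ^ (ε / 4) / (ε / 4) :=
      Real.log_le_rpow_div (by linarith) (by linarith)
    have h2 : ((n : ℝ) + 1) ^ (ε / 4) ≤ z := by
      have hsq : (n : ℝ) + 1 ≤ (n : ℝ) ^ (2 : ℝ) := by
        rw [show (2 : ℝ) = ((2 : ℕ) : ℝ) from by norm_num, Real.rpow_natCast]
        nlinarith
      calc ((n : ℝ) + 1) ^ (ε / 4) ≤ ((n : ℝ) ^ (2 : ℝ)) ^ (ε / 4) :=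
            Real.rpow_le_rpow (by linarith) hsq (by linarith)
        _ = z := by rw [hz, ← Real.rpow_mul hn0.le]; congr 1; ring
    have h3 : ((n : ℝ) + 1) ^ (ε / 4) / (ε / 4) ≤ z / (ε / 4) :=
      div_le_div_of_nonneg_right h2 (by linarith)
    calc Real.log ((n : ℝ) + 1) ≤ z / (ε / 4) := h1.trans h3
      _ = 4 / ε * z := by field_simp
  -- compare logarithms
  have hK1 : Real.log ((K : ℝ) + 1) ≤ K := by
    have := Real.log_le_sub_one_of_pos (show (0 : ℝ) < K + 1 by positivity)
    linarith
  have hmain : Real.log (((K : ℝ) + 1) * ((n : ℝ) + 1) ^ c) < Real.log 2 * z ^ 2 := by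
    rw [Real.log_mul (by positivity) (by positivity), Real.log_pow]
    have hc0 : (0 : ℝ) ≤ c := Nat.cast_nonneg c
    have h1 : (c : ℝ) * Real.log ((n : ℝ) + 1) ≤ c * (4 / ε * z) :=
      mul_le_mul_of_nonneg_left hlogn hc0
    have h2 : (K : ℝ) + 4 * c / ε + 1 ≤ Real.log 2 * z := by
      have h2' : ((K : ℝ) + 4 * c / ε + 1) / Real.log 2 ≤ z := by linarith [hzZ]
      have h2'' := (div_le_iff₀ hlog2).1 h2'
      linarith [h2'']
    have h3 : ((K : ℝ) + 4 * c / ε + 1) * z ≤ Real.log 2 * z * z :=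
      mul_le_mul_of_nonneg_right h2 hz0.le
    have h4 : (K : ℝ) * 1 ≤ K * z := mul_le_mul_of_nonneg_left hz1 (Nat.cast_nonneg K)
    have e : (c : ℝ) * (4 / ε * z) = 4 * c / ε * z := by ring
    nlinarith [h1, h3, h4, hK1, e, hz1]
  -- exponentiate
  have hpos : (0 : ℝ) < ((K : ℝ) + 1) * ((n : ℝ) + 1) ^ c := by positivity
  have hlt : ((K : ℝ) + 1) * ((n : ℝ) + 1) ^ c < (2 : ℝ) ^ ((n : ℝ) ^ ε) := by
    rw [hnε, Real.rpow_def_of_pos two_pos, ← Real.exp_log hpos]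
    exact Real.exp_lt_exp.2 hmain
  calc ((K * (n + 1) ^ c : ℕ) : ℝ) = (K : ℝ) * ((n : ℝ) + 1) ^ c := by push_cast; ring
    _ ≤ ((K : ℝ) + 1) * ((n : ℝ) + 1) ^ c :=
        mul_le_mul_of_nonneg_right (by linarith) (by positivity)
    _ < _ := hlt

/-! ### The corollary -/

/-- **The `p = 2` analogue of `LinearGeneratorModPFregeHard` forces solvability.** Suppose the
rung's statement with `p = 2` (hypothesis `H`: for all `ℓ ≥ 1`, `d`, `0 < δ < 1` there are
`ε > 0`, `N` such that beyond `N` every depth-`d` `textbookFrege(MOD₂)`-proof of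
`¬ofCNF (sumEncoding 1 E)` for an `ℓ`-sparse `(n^(1-δ),3ℓ/4)`-boundary-expanding unsolvable `E`
has size `≥ 2^(n^ε)`).  Then for all `ℓ ≥ 1`, `0 < δ < 1` and all large `n`, EVERY `ℓ`-sparse
`(n^(1-δ),3ℓ/4)`-boundary-expanding system over `𝔽₂` is solvable: an unsolvable one would have the
polynomial-size depth-35 refutation of `exists_modTwo_refutation`, below `2^(n^ε)`.  So the `p = 2`
statement carries no proof-complexity content, which is why the rung excludes `p = 2`.
[Buss et al. 1997, Def. 1.1; Krajíček 2019, §15.6] [folklore] -/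
theorem solvable_of_linearGeneratorModTwoFregeHard
    (H : ∀ (ℓ d : ℕ) (δ : ℝ), 1 ≤ ℓ → 0 < δ → δ < 1 → ∃ ε : ℝ, 0 < ε ∧ ∃ N : ℕ, ∀ n : ℕ, N ≤ n →
      ∀ (m : ℕ) (E : Fin m → LinEqMod 2 n), (∀ i, (E i).supp.card ≤ ℓ) →
      IsBoundaryExpander (fun i => (E i).supp.map Fin.valEmbedding) ((n : ℝ) ^ (1 - δ))
        (3 / 4 * ℓ) →
      ¬ SystemSat E Finset.univ →
      ∀ π : List (PropFormMod 2 ℕ), textbookFrege.IsModDepthProofOf d π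
        (PropFormMod.ofPropForm (PropForm.neg (PropForm.ofCNF (sumEncoding 1 E)))) →
        (2 : ℝ) ^ ((n : ℝ) ^ ε) ≤ (modProofSize π : ℝ))
    (ℓ : ℕ) (δ : ℝ) (hℓ : 1 ≤ ℓ) (hδ : 0 < δ) (hδ1 : δ < 1) :
    ∃ N : ℕ, ∀ n : ℕ, N ≤ n → ∀ (m : ℕ) (E : Fin m → LinEqMod 2 n),
      (∀ i, (E i).supp.card ≤ ℓ) →
      IsBoundaryExpander (fun i => (E i).supp.map Fin.valEmbedding) ((n : ℝ) ^ (1 - δ))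
        (3 / 4 * ℓ) →
      SystemSat E Finset.univ := by
  obtain ⟨d₀, c, href⟩ := exists_modTwo_refutation
  obtain ⟨ε, hε, N₁, hN₁⟩ := H ℓ d₀ δ hℓ hδ hδ1
  obtain ⟨N₂, hN₂⟩ := exists_nat_poly_lt_two_rpow
    (((ℓ + 1) * (2 ^ ℓ * (3 * ℓ + 2) + 1) + 4) ^ c) (ℓ * c) hε
  refine ⟨max N₁ (max N₂ ⌈(2 : ℝ) ^ (1 / (1 - δ))⌉₊), fun n hn m E hsparse hexp => ?_⟩
  have hn₁ : N₁ ≤ n := le_of_max_le_left hn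
  have hn₂ : N₂ ≤ n := le_of_max_le_left (le_of_max_le_right hn)
  have hn₃ : ⌈(2 : ℝ) ^ (1 / (1 - δ))⌉₊ ≤ n := le_of_max_le_right (le_of_max_le_right hn)
  by_contra hsat
  -- the polynomial-size refutation …
  obtain ⟨π, hπ, hsize⟩ := href n m E hsat
  -- … of an instance polynomial in `n` …
  have hr : (2 : ℝ) ≤ (n : ℝ) ^ (1 - δ) := two_le_rpow_of_ceil_le hδ1 hn₃
  have hinj : Function.Injective fun i => (E i).supp := fun i j hij => by
    by_contra hne
    exact supp_ne_of_expander E hℓ hr hexp hne hij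
  have hX := param_le_of_sparse E hℓ hsparse hinj
  have hbound : modProofSize π ≤
      ((ℓ + 1) * (2 ^ ℓ * (3 * ℓ + 2) + 1) + 4) ^ c * (n + 1) ^ (ℓ * c) := by
    refine hsize.trans ((Nat.pow_le_pow_left hX c).trans (le_of_eq ?_))
    rw [Nat.mul_pow, ← pow_mul]
  -- … beats the exponential lower bound
  have hlow := hN₁ n hn₁ m E hsparse hexp hsat π hπ
  have hup := hN₂ n hn₂
  have hcast : (modProofSize π : ℝ) ≤
      ((((ℓ + 1) * (2 ^ ℓ * (3 * ℓ + 2) + 1) + 4) ^ c * (n + 1) ^ (ℓ * c) : ℕ) : ℝ) := by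
    exact_mod_cast hbound
  linarith

end Summit.PneNP.PneNP.Theorems.ModTwo
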